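import Summits.CriticalPhenomena.PercolationContinuityZ3.Theorems.Transplant.FKConnectivityAllQPat3Levels
import HarnessLib

/-!
# Connectivity correlation inequalities for `φ_{w,q}`, every `q > 0` — THE PRODUCT-CONE LEMMA for three-piece gluings (Stage S2,
# part 2b): product tensors, target tensors, and the soundness of census g32/g34's product-cone certificates

Definitions + theorems file (`--supports stmt-CriticalPhenomena-4575`), census lane `prim-bschramm-census` (gen 36) of the post-continuity programme (LANE 2 bschramm, FK sub-lane);
builds on p205010 (kernel theorem, internal audit signed; external expert review pending).
No named facts, no sorries; standard axioms.  Census g34 PROOF-THEOREM-SP §2.2 ("product-cone certificate ⇒ the form is nonnegative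
at every level") made a kernel lemma, generic over the gluing law:
* `FK.Prod3` (one product: multiplier numerator `lam`, level shift, three two-level generator tables), `FK.Prod3.tensor`
  (`π(d; ·) = Σ_{c_K+c_1+c_2+κ=d} g_K g_1 g_2`), `FK.target3 join corr T` (`τ(d; P, Q) = Σ_c 1{corr P + corr Q + c = d} T c (join P) (join Q)`).
* `FK.lev2_decomp3` — the levelwise (integer) form of the trilinear decompositions `FK.tval_union3_theta` / `FK.tval_union3_ring`
  (taken as the hypothesis `hdec`, so the lemma serves THETA, RING and any further configuration alike).
* **`FK.cone3_level_nonneg`** — if `hdec` holds with level offset `S`, a certificate holds entrywise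
  (`Σ_j λ_j π_j(d;·) ≤ D · τ_T(d;·)` for all `d` and all pattern-pair triples; `D` = common denominator, products indexed by a
  `Finset`), and every generator is levelwise nonnegative on its piece, then `0 ≤ D · lev2 G b s t T λ` at every level `λ` —
  the composite value dominates `Σ_j λ_j Σ_{μ_K+μ_1+μ_2+κ_j=λ+S} Π_p g_{j,p}(piece_p)(μ_p) ≥ 0` (`FK.regroup1` thrice).
* `FK.certCheck3` (computable `Bool`) / `FK.certCheck3_spec` — the EXECUTABLE CHECK producing the entrywise hypothesis from a
  product list by `decide` (level offsets `d < B + 6` suffice when shifts are `≤ B` and corrections `≤ 2`); `FK.list_sum_eq_finset_sum`.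
What remains for Stage S2: running the check on data (THETA_TS 111 /
THETA_STAR 191 / RING_TS 179 / RING_STAR 157 products over ≤ 15,625 pattern-pair triples × 6 level offsets — see census g36's
memo §7 on the cost), the data files, and the instantiations (`join3`/`corr3` with `FK.tval_union3_theta`, `joinRing`/`corrRing`
with `FK.tval_union3_ring`; generators from `FK.famT12_nonneg` / `FK.uRect_nonneg` via `FK.lev2_nonneg_of_mval2`).
[cite: AyyerLinussonRavichandran2025, §7 eq. (13)–(15) (p. 22)] [cite: Grimmett2006, §3.8 (pp. 61–62)]
-/

noncomputable section

namespace Summit.CriticalPhenomena.PercolationContinuityZ3.Theorems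

namespace FK

open SimpleGraph Literature.Probability.LatticeModels Literature.Probability.Percolation

/-! ### Product-cone certificates for a three-piece gluing (census g32 §2.2 / g34 PROOF-THEOREM-SP §2.2) -/

/-- One product of a three-piece product-cone certificate: a nonnegative integer multiplier, a level shift, and three two-level
generator tables (one per piece, in the piece's positional coordinates). [folklore] -/
structure Prod3 where
  /-- numerator of the multiplier `λ_j` (the common denominator is the certificate's `D`) -/
  lam : ℕ
  /-- level shift `κ_j` of the product -/
  shift : ℕ
  /-- generator on the first piece -/
  gK : ℕ → Pat3 → Pat3 → ℤ
  /-- generator on the second piece -/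
  g1 : ℕ → Pat3 → Pat3 → ℤ
  /-- generator on the third piece -/
  g2 : ℕ → Pat3 → Pat3 → ℤ

/-- The tensor of a product at composite level offset `d` and pattern-pair triple: `Σ_{c_K+c_1+c_2+κ = d} g_K g_1 g_2`. [folklore] -/
def Prod3.tensor (p : Prod3) (d : ℕ) (PK QK P1 Q1 P2 Q2 : Pat3) : ℤ :=
  ∑ cK ∈ Finset.range 2, ∑ c1 ∈ Finset.range 2, ∑ c2 ∈ Finset.range 2,
    if cK + c1 + c2 + p.shift = d then p.gK cK PK QK * p.g1 c1 P1 Q1 * p.g2 c2 P2 Q2 else 0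

/-- The TARGET tensor of a two-level member `T` of the composite under a join/correction law:
`τ(d; P, Q) = Σ_c 1{corr P + corr Q + c = d} T c (join P) (join Q)`. [folklore] -/
def target3 (join : Pat3 → Pat3 → Pat3 → Pat3) (corr : Pat3 → Pat3 → Pat3 → ℕ) (T : ℕ → Pat3 → Pat3 → ℤ) (d : ℕ)
    (PK QK P1 Q1 P2 Q2 : Pat3) : ℤ :=
  ∑ c ∈ Finset.range 2, if corr PK P1 P2 + corr QK Q1 Q2 + c = d then T c (join PK P1 P2) (join QK Q1 Q2) else 0


section Cone

open scoped Classical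

variable {V : Type*}

/-- **Levelwise trilinear decomposition** of a two-level member over a three-piece gluing (integer form of
`FK.tval_union3_theta` / `FK.tval_union3_ring`). [folklore] -/
theorem lev2_decomp3 {EK E₁ E₂ G : Finset (Sym2 V)} {b s t uK vK mK u₁ v₁ m₁ u₂ v₂ m₂ : V}
    (join : Pat3 → Pat3 → Pat3 → Pat3) (corr : Pat3 → Pat3 → Pat3 → ℕ) (S : ℕ)
    (hdec : ∀ (w : ℕ → ℝ) (tab : Pat3 → Pat3 → ℤ),
      tval (fun n => w (n + S)) G b s t tab =
        ∑ γK ∈ EK.powerset, ∑ γ₁ ∈ E₁.powerset, ∑ γ₂ ∈ E₂.powerset,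
          w (apExp EK γK + apExp E₁ γ₁ + apExp E₂ γ₂ +
                corr (pat3 γK uK vK mK) (pat3 γ₁ u₁ v₁ m₁) (pat3 γ₂ u₂ v₂ m₂) +
              corr (pat3 (EK \ γK) uK vK mK) (pat3 (E₁ \ γ₁) u₁ v₁ m₁) (pat3 (E₂ \ γ₂) u₂ v₂ m₂)) *
            (tab (join (pat3 γK uK vK mK) (pat3 γ₁ u₁ v₁ m₁) (pat3 γ₂ u₂ v₂ m₂))
              (join (pat3 (EK \ γK) uK vK mK) (pat3 (E₁ \ γ₁) u₁ v₁ m₁) (pat3 (E₂ \ γ₂) u₂ v₂ m₂)) : ℝ))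
    (T : ℕ → Pat3 → Pat3 → ℤ) (lam0 : ℕ) :
    lev2 G b s t T lam0 = ∑ γK ∈ EK.powerset, ∑ γ₁ ∈ E₁.powerset, ∑ γ₂ ∈ E₂.powerset,
      ((if apExp EK γK + apExp E₁ γ₁ + apExp E₂ γ₂ +
            corr (pat3 γK uK vK mK) (pat3 γ₁ u₁ v₁ m₁) (pat3 γ₂ u₂ v₂ m₂) +
            corr (pat3 (EK \ γK) uK vK mK) (pat3 (E₁ \ γ₁) u₁ v₁ m₁) (pat3 (E₂ \ γ₂) u₂ v₂ m₂) = lam0 + S then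
          T 0 (join (pat3 γK uK vK mK) (pat3 γ₁ u₁ v₁ m₁) (pat3 γ₂ u₂ v₂ m₂))
            (join (pat3 (EK \ γK) uK vK mK) (pat3 (E₁ \ γ₁) u₁ v₁ m₁) (pat3 (E₂ \ γ₂) u₂ v₂ m₂)) else 0) +
        (if apExp EK γK + apExp E₁ γ₁ + apExp E₂ γ₂ +
            corr (pat3 γK uK vK mK) (pat3 γ₁ u₁ v₁ m₁) (pat3 γ₂ u₂ v₂ m₂) +
            corr (pat3 (EK \ γK) uK vK mK) (pat3 (E₁ \ γ₁) u₁ v₁ m₁) (pat3 (E₂ \ γ₂) u₂ v₂ m₂) + 1 = lam0 + S then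
          T 1 (join (pat3 γK uK vK mK) (pat3 γ₁ u₁ v₁ m₁) (pat3 γ₂ u₂ v₂ m₂))
            (join (pat3 (EK \ γK) uK vK mK) (pat3 (E₁ \ γ₁) u₁ v₁ m₁) (pat3 (E₂ \ γ₂) u₂ v₂ m₂)) else 0)) := by
  have hw0 : (fun n : ℕ => if n = lam0 then (1 : ℝ) else 0) =
      fun n => (fun m : ℕ => if m = lam0 + S then (1 : ℝ) else 0) (n + S) := by
    funext n
    have e : (n = lam0) ↔ (n + S = lam0 + S) := by constructor <;> intro h <;> omega
    simp only [e]
  have h1 := hdec (fun m : ℕ => if m = lam0 + S then (1 : ℝ) else 0) (T 0)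
  have h2 := hdec (fun m : ℕ => if m + 1 = lam0 + S then (1 : ℝ) else 0) (T 1)
  have key : (lev2 G b s t T lam0 : ℝ) = _ := lev2_cast G b s t T lam0
  rw [mval2_eq_tval_add, hw0, h1] at key
  have hw1 : (fun n : ℕ => if n + 1 = lam0 then (1 : ℝ) else 0) =
      fun n => (fun m : ℕ => if m + 1 = lam0 + S then (1 : ℝ) else 0) (n + S) := by
    funext n
    have e : (n + 1 = lam0) ↔ (n + S + 1 = lam0 + S) := by constructor <;> intro h <;> omega
    simp only [e]
  rw [hw1, h2, ← Finset.sum_add_distrib] at key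
  have : ((lev2 G b s t T lam0 : ℤ) : ℝ) = ((∑ γK ∈ EK.powerset, ∑ γ₁ ∈ E₁.powerset, ∑ γ₂ ∈ E₂.powerset,
      ((if apExp EK γK + apExp E₁ γ₁ + apExp E₂ γ₂ +
            corr (pat3 γK uK vK mK) (pat3 γ₁ u₁ v₁ m₁) (pat3 γ₂ u₂ v₂ m₂) +
            corr (pat3 (EK \ γK) uK vK mK) (pat3 (E₁ \ γ₁) u₁ v₁ m₁) (pat3 (E₂ \ γ₂) u₂ v₂ m₂) = lam0 + S then
          T 0 (join (pat3 γK uK vK mK) (pat3 γ₁ u₁ v₁ m₁) (pat3 γ₂ u₂ v₂ m₂))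
            (join (pat3 (EK \ γK) uK vK mK) (pat3 (E₁ \ γ₁) u₁ v₁ m₁) (pat3 (E₂ \ γ₂) u₂ v₂ m₂)) else 0) +
        (if apExp EK γK + apExp E₁ γ₁ + apExp E₂ γ₂ +
            corr (pat3 γK uK vK mK) (pat3 γ₁ u₁ v₁ m₁) (pat3 γ₂ u₂ v₂ m₂) +
            corr (pat3 (EK \ γK) uK vK mK) (pat3 (E₁ \ γ₁) u₁ v₁ m₁) (pat3 (E₂ \ γ₂) u₂ v₂ m₂) + 1 = lam0 + S then
          T 1 (join (pat3 γK uK vK mK) (pat3 γ₁ u₁ v₁ m₁) (pat3 γ₂ u₂ v₂ m₂))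
            (join (pat3 (EK \ γK) uK vK mK) (pat3 (E₁ \ γ₁) u₁ v₁ m₁) (pat3 (E₂ \ γ₂) u₂ v₂ m₂)) else 0)) : ℤ) : ℝ) := by
    rw [key]
    push_cast
    refine Finset.sum_congr rfl fun γK _ => ?_
    rw [← Finset.sum_add_distrib]
    refine Finset.sum_congr rfl fun γ₁ _ => ?_
    rw [← Finset.sum_add_distrib]
    refine Finset.sum_congr rfl fun γ₂ _ => ?_
    set N := apExp EK γK + apExp E₁ γ₁ + apExp E₂ γ₂ + corr (pat3 γK uK vK mK) (pat3 γ₁ u₁ v₁ m₁) (pat3 γ₂ u₂ v₂ m₂) +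
      corr (pat3 (EK \ γK) uK vK mK) (pat3 (E₁ \ γ₁) u₁ v₁ m₁) (pat3 (E₂ \ γ₂) u₂ v₂ m₂) with hN
    by_cases a0 : N = lam0 + S <;> by_cases a1 : N + 1 = lam0 + S
    · exfalso; omega
    · simp [a0]
    · simp [a0, a1]
    · simp [a0, a1]
  exact_mod_cast this


/-- **PRODUCT-CONE LEMMA FOR A THREE-PIECE GLUING (census g32 §2.2 / g34 PROOF-THEOREM-SP §2.2; kernel).**  Suppose the weighted
evaluation of tables on the composite `(G; b, s, t)` decomposes over configuration triples of the pieces `E_K, E₁, E₂` through a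
join/correction law (`hdec` — `FK.tval_union3_theta` / `FK.tval_union3_ring`), a product-cone certificate for the two-level target
`T` holds entrywise with common denominator `D` (`hcert`: `Σ_j λ_j π_j ≤ D·τ_T` at every level offset and pattern-pair triple),
and every generator of every product is levelwise nonnegative on its piece (`hval`).  Then `T` is levelwise nonnegative on the
composite: `0 ≤ D · lev2 G b s t T λ` at every level `λ` — at each level the composite value dominates
`Σ_j λ_j Σ_{μ_K+μ_1+μ_2+κ_j = λ} Π_p g_{j,p}(piece_p)(μ_p) ≥ 0`. [cite: AyyerLinussonRavichandran2025, §7 (p. 22)] -/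
theorem cone3_level_nonneg {EK E₁ E₂ G : Finset (Sym2 V)} {b s t uK vK mK u₁ v₁ m₁ u₂ v₂ m₂ : V}
    (join : Pat3 → Pat3 → Pat3 → Pat3) (corr : Pat3 → Pat3 → Pat3 → ℕ) (S : ℕ)
    (hdec : ∀ (w : ℕ → ℝ) (tab : Pat3 → Pat3 → ℤ),
      tval (fun n => w (n + S)) G b s t tab =
        ∑ γK ∈ EK.powerset, ∑ γ₁ ∈ E₁.powerset, ∑ γ₂ ∈ E₂.powerset,
          w (apExp EK γK + apExp E₁ γ₁ + apExp E₂ γ₂ +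
                corr (pat3 γK uK vK mK) (pat3 γ₁ u₁ v₁ m₁) (pat3 γ₂ u₂ v₂ m₂) +
              corr (pat3 (EK \ γK) uK vK mK) (pat3 (E₁ \ γ₁) u₁ v₁ m₁) (pat3 (E₂ \ γ₂) u₂ v₂ m₂)) *
            (tab (join (pat3 γK uK vK mK) (pat3 γ₁ u₁ v₁ m₁) (pat3 γ₂ u₂ v₂ m₂))
              (join (pat3 (EK \ γK) uK vK mK) (pat3 (E₁ \ γ₁) u₁ v₁ m₁) (pat3 (E₂ \ γ₂) u₂ v₂ m₂)) : ℝ))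
    (T : ℕ → Pat3 → Pat3 → ℤ) (D : ℕ) {ι : Type*} (J : Finset ι) (prod : ι → Prod3)
    (hcert : ∀ d : ℕ, ∀ PK QK P1 Q1 P2 Q2 : Pat3,
      ∑ j ∈ J, ((prod j).lam : ℤ) * (prod j).tensor d PK QK P1 Q1 P2 Q2 ≤ D * target3 join corr T d PK QK P1 Q1 P2 Q2)
    (hval : ∀ j ∈ J, ∀ μ : ℕ,
      0 ≤ lev2 EK uK vK mK (prod j).gK μ ∧ 0 ≤ lev2 E₁ u₁ v₁ m₁ (prod j).g1 μ ∧ 0 ≤ lev2 E₂ u₂ v₂ m₂ (prod j).g2 μ)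
    (lam0 : ℕ) : 0 ≤ (D : ℤ) * lev2 G b s t T lam0 := by
  rw [lev2_decomp3 join corr S hdec T lam0, Finset.mul_sum]
  -- per triple: the product side
  set N := lam0 + S with hNdef
  set B : Prod3 → Finset (Sym2 V) → Finset (Sym2 V) → Finset (Sym2 V) → ℤ := fun p γK γ₁ γ₂ =>
    ∑ cK ∈ Finset.range 2, ∑ c1 ∈ Finset.range 2, ∑ c2 ∈ Finset.range 2,
      (if apExp EK γK + apExp E₁ γ₁ + apExp E₂ γ₂ + (cK + c1 + c2 + p.shift) = N then
        p.gK cK (pat3 γK uK vK mK) (pat3 (EK \ γK) uK vK mK) * p.g1 c1 (pat3 γ₁ u₁ v₁ m₁) (pat3 (E₁ \ γ₁) u₁ v₁ m₁) *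
          p.g2 c2 (pat3 γ₂ u₂ v₂ m₂) (pat3 (E₂ \ γ₂) u₂ v₂ m₂) else 0) with hB
  -- Step 2: certificate, triple by triple
  have step2 : ∀ γK γ₁ γ₂, ∑ j ∈ J, ((prod j).lam : ℤ) * B (prod j) γK γ₁ γ₂ ≤
      (D : ℤ) * ((if apExp EK γK + apExp E₁ γ₁ + apExp E₂ γ₂ +
            corr (pat3 γK uK vK mK) (pat3 γ₁ u₁ v₁ m₁) (pat3 γ₂ u₂ v₂ m₂) +
            corr (pat3 (EK \ γK) uK vK mK) (pat3 (E₁ \ γ₁) u₁ v₁ m₁) (pat3 (E₂ \ γ₂) u₂ v₂ m₂) = N then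
          T 0 (join (pat3 γK uK vK mK) (pat3 γ₁ u₁ v₁ m₁) (pat3 γ₂ u₂ v₂ m₂))
            (join (pat3 (EK \ γK) uK vK mK) (pat3 (E₁ \ γ₁) u₁ v₁ m₁) (pat3 (E₂ \ γ₂) u₂ v₂ m₂)) else 0) +
        (if apExp EK γK + apExp E₁ γ₁ + apExp E₂ γ₂ +
            corr (pat3 γK uK vK mK) (pat3 γ₁ u₁ v₁ m₁) (pat3 γ₂ u₂ v₂ m₂) +
            corr (pat3 (EK \ γK) uK vK mK) (pat3 (E₁ \ γ₁) u₁ v₁ m₁) (pat3 (E₂ \ γ₂) u₂ v₂ m₂) + 1 = N then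
          T 1 (join (pat3 γK uK vK mK) (pat3 γ₁ u₁ v₁ m₁) (pat3 γ₂ u₂ v₂ m₂))
            (join (pat3 (EK \ γK) uK vK mK) (pat3 (E₁ \ γ₁) u₁ v₁ m₁) (pat3 (E₂ \ γ₂) u₂ v₂ m₂)) else 0)) := by
    intro γK γ₁ γ₂
    set e := apExp EK γK + apExp E₁ γ₁ + apExp E₂ γ₂ with he
    by_cases hle : e ≤ N
    · obtain ⟨d, hd⟩ := Nat.exists_eq_add_of_le hle
      have htarget : ((if e + corr (pat3 γK uK vK mK) (pat3 γ₁ u₁ v₁ m₁) (pat3 γ₂ u₂ v₂ m₂) +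
            corr (pat3 (EK \ γK) uK vK mK) (pat3 (E₁ \ γ₁) u₁ v₁ m₁) (pat3 (E₂ \ γ₂) u₂ v₂ m₂) = N then
          T 0 (join (pat3 γK uK vK mK) (pat3 γ₁ u₁ v₁ m₁) (pat3 γ₂ u₂ v₂ m₂))
            (join (pat3 (EK \ γK) uK vK mK) (pat3 (E₁ \ γ₁) u₁ v₁ m₁) (pat3 (E₂ \ γ₂) u₂ v₂ m₂)) else 0) +
        (if e + corr (pat3 γK uK vK mK) (pat3 γ₁ u₁ v₁ m₁) (pat3 γ₂ u₂ v₂ m₂) +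
            corr (pat3 (EK \ γK) uK vK mK) (pat3 (E₁ \ γ₁) u₁ v₁ m₁) (pat3 (E₂ \ γ₂) u₂ v₂ m₂) + 1 = N then
          T 1 (join (pat3 γK uK vK mK) (pat3 γ₁ u₁ v₁ m₁) (pat3 γ₂ u₂ v₂ m₂))
            (join (pat3 (EK \ γK) uK vK mK) (pat3 (E₁ \ γ₁) u₁ v₁ m₁) (pat3 (E₂ \ γ₂) u₂ v₂ m₂)) else 0)) =
          target3 join corr T d (pat3 γK uK vK mK) (pat3 (EK \ γK) uK vK mK) (pat3 γ₁ u₁ v₁ m₁) (pat3 (E₁ \ γ₁) u₁ v₁ m₁)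
            (pat3 γ₂ u₂ v₂ m₂) (pat3 (E₂ \ γ₂) u₂ v₂ m₂) := by
        unfold target3
        rw [Finset.sum_range_succ, Finset.sum_range_succ, Finset.sum_range_zero, zero_add]
        congr 1 <;> split_ifs <;> first | rfl | (exfalso; omega)
      have htensor : ∀ p : Prod3, B p γK γ₁ γ₂ = p.tensor d (pat3 γK uK vK mK) (pat3 (EK \ γK) uK vK mK)
          (pat3 γ₁ u₁ v₁ m₁) (pat3 (E₁ \ γ₁) u₁ v₁ m₁) (pat3 γ₂ u₂ v₂ m₂) (pat3 (E₂ \ γ₂) u₂ v₂ m₂) := by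
        intro p
        simp only [hB, Prod3.tensor]
        refine Finset.sum_congr rfl fun cK _ => Finset.sum_congr rfl fun c1 _ => Finset.sum_congr rfl fun c2 _ => ?_
        split_ifs <;> first | rfl | (exfalso; omega)
      rw [htarget]
      have := hcert d (pat3 γK uK vK mK) (pat3 (EK \ γK) uK vK mK) (pat3 γ₁ u₁ v₁ m₁) (pat3 (E₁ \ γ₁) u₁ v₁ m₁)
        (pat3 γ₂ u₂ v₂ m₂) (pat3 (E₂ \ γ₂) u₂ v₂ m₂)
      refine le_trans (le_of_eq (Finset.sum_congr rfl fun j _ => by rw [htensor (prod j)])) this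
    · -- beyond the top level everything vanishes
      rw [not_le] at hle
      have z1 : ∀ p : Prod3, B p γK γ₁ γ₂ = 0 := by
        intro p
        simp only [hB]
        refine Finset.sum_eq_zero fun cK _ => Finset.sum_eq_zero fun c1 _ => Finset.sum_eq_zero fun c2 _ => ?_
        have : ¬ (e + (cK + c1 + c2 + p.shift) = N) := by omega
        rw [if_neg this]
      have h0 : ¬ (e + corr (pat3 γK uK vK mK) (pat3 γ₁ u₁ v₁ m₁) (pat3 γ₂ u₂ v₂ m₂) +
            corr (pat3 (EK \ γK) uK vK mK) (pat3 (E₁ \ γ₁) u₁ v₁ m₁) (pat3 (E₂ \ γ₂) u₂ v₂ m₂) = N) := by omega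
      have h1 : ¬ (e + corr (pat3 γK uK vK mK) (pat3 γ₁ u₁ v₁ m₁) (pat3 γ₂ u₂ v₂ m₂) +
            corr (pat3 (EK \ γK) uK vK mK) (pat3 (E₁ \ γ₁) u₁ v₁ m₁) (pat3 (E₂ \ γ₂) u₂ v₂ m₂) + 1 = N) := by omega
      rw [if_neg h0, if_neg h1, add_zero, mul_zero]
      exact le_of_eq (Finset.sum_eq_zero fun j _ => by rw [z1 (prod j), mul_zero])
  -- Step 3: the product side summed over triples is nonnegative (regrouping piece by piece)
  have step3 : ∀ p : Prod3, (∀ μ : ℕ, 0 ≤ lev2 EK uK vK mK p.gK μ ∧ 0 ≤ lev2 E₁ u₁ v₁ m₁ p.g1 μ ∧ 0 ≤ lev2 E₂ u₂ v₂ m₂ p.g2 μ) →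
      0 ≤ ∑ γK ∈ EK.powerset, ∑ γ₁ ∈ E₁.powerset, ∑ γ₂ ∈ E₂.powerset, B p γK γ₁ γ₂ := by
    intro p hp
    -- piece 2
    have E01 : ∑ γK ∈ EK.powerset, ∑ γ₁ ∈ E₁.powerset, ∑ γ₂ ∈ E₂.powerset, B p γK γ₁ γ₂ =
        ∑ γK ∈ EK.powerset, ∑ γ₁ ∈ E₁.powerset, ∑ cK ∈ Finset.range 2, ∑ c1 ∈ Finset.range 2,
          ∑ μ2 ∈ Finset.range (N + 1), (if μ2 + (apExp EK γK + cK + apExp E₁ γ₁ + c1 + p.shift) = N then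
            lev2 E₂ u₂ v₂ m₂ p.g2 μ2 * (p.gK cK (pat3 γK uK vK mK) (pat3 (EK \ γK) uK vK mK) *
              p.g1 c1 (pat3 γ₁ u₁ v₁ m₁) (pat3 (E₁ \ γ₁) u₁ v₁ m₁)) else 0) := by
      refine Finset.sum_congr rfl fun γK _ => Finset.sum_congr rfl fun γ₁ _ => ?_
      simp only [hB]
      rw [Finset.sum_comm]
      refine Finset.sum_congr rfl fun cK _ => ?_
      rw [Finset.sum_comm]
      refine Finset.sum_congr rfl fun c1 _ => ?_
      rw [← regroup1 E₂ u₂ v₂ m₂ p.g2 N (apExp EK γK + cK + apExp E₁ γ₁ + c1 + p.shift)]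
      refine Finset.sum_congr rfl fun γ₂ _ => Finset.sum_congr rfl fun c2 _ => ?_
      exact ite_eq_ite_of_iff (by constructor <;> intro h <;> omega) (by ring)
    -- piece 1
    have E12 : ∑ γK ∈ EK.powerset, ∑ γ₁ ∈ E₁.powerset, ∑ cK ∈ Finset.range 2, ∑ c1 ∈ Finset.range 2,
          ∑ μ2 ∈ Finset.range (N + 1), (if μ2 + (apExp EK γK + cK + apExp E₁ γ₁ + c1 + p.shift) = N then
            lev2 E₂ u₂ v₂ m₂ p.g2 μ2 * (p.gK cK (pat3 γK uK vK mK) (pat3 (EK \ γK) uK vK mK) *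
              p.g1 c1 (pat3 γ₁ u₁ v₁ m₁) (pat3 (E₁ \ γ₁) u₁ v₁ m₁)) else 0) =
        ∑ γK ∈ EK.powerset, ∑ cK ∈ Finset.range 2, ∑ μ2 ∈ Finset.range (N + 1), ∑ μ1 ∈ Finset.range (N + 1),
          (if μ1 + (apExp EK γK + cK + μ2 + p.shift) = N then
            lev2 E₁ u₁ v₁ m₁ p.g1 μ1 * (lev2 E₂ u₂ v₂ m₂ p.g2 μ2 * p.gK cK (pat3 γK uK vK mK) (pat3 (EK \ γK) uK vK mK))
            else 0) := by
      refine Finset.sum_congr rfl fun γK _ => ?_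
      rw [Finset.sum_comm]
      refine Finset.sum_congr rfl fun cK _ => ?_
      -- Σ γ₁ Σ c1 Σ μ2 → Σ μ2 Σ γ₁ Σ c1
      rw [Finset.sum_congr rfl fun γ₁ _ => Finset.sum_comm, Finset.sum_comm]
      refine Finset.sum_congr rfl fun μ2 _ => ?_
      rw [← regroup1 E₁ u₁ v₁ m₁ p.g1 N (apExp EK γK + cK + μ2 + p.shift)]
      refine Finset.sum_congr rfl fun γ₁ _ => Finset.sum_congr rfl fun c1 _ => ?_
      exact ite_eq_ite_of_iff (by constructor <;> intro h <;> omega) (by ring)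
    -- piece K
    have E23 : ∑ γK ∈ EK.powerset, ∑ cK ∈ Finset.range 2, ∑ μ2 ∈ Finset.range (N + 1), ∑ μ1 ∈ Finset.range (N + 1),
          (if μ1 + (apExp EK γK + cK + μ2 + p.shift) = N then
            lev2 E₁ u₁ v₁ m₁ p.g1 μ1 * (lev2 E₂ u₂ v₂ m₂ p.g2 μ2 * p.gK cK (pat3 γK uK vK mK) (pat3 (EK \ γK) uK vK mK))
            else 0) =
        ∑ μ2 ∈ Finset.range (N + 1), ∑ μ1 ∈ Finset.range (N + 1), ∑ μK ∈ Finset.range (N + 1),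
          (if μK + (μ1 + μ2 + p.shift) = N then
            lev2 EK uK vK mK p.gK μK * (lev2 E₁ u₁ v₁ m₁ p.g1 μ1 * lev2 E₂ u₂ v₂ m₂ p.g2 μ2) else 0) := by
      -- Σ γK Σ cK Σ μ2 Σ μ1 → Σ μ2 Σ μ1 Σ γK Σ cK
      rw [Finset.sum_congr rfl fun γK _ => Finset.sum_comm]
      rw [Finset.sum_congr rfl fun γK _ => Finset.sum_congr rfl fun μ2 _ => Finset.sum_comm]
      rw [Finset.sum_comm]
      refine Finset.sum_congr rfl fun μ2 _ => ?_
      rw [Finset.sum_comm]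
      refine Finset.sum_congr rfl fun μ1 _ => ?_
      rw [← regroup1 EK uK vK mK p.gK N (μ1 + μ2 + p.shift)]
      refine Finset.sum_congr rfl fun γK _ => Finset.sum_congr rfl fun cK _ => ?_
      exact ite_eq_ite_of_iff (by constructor <;> intro h <;> omega) (by ring)
    rw [E01, E12, E23]
    refine Finset.sum_nonneg fun μ2 _ => Finset.sum_nonneg fun μ1 _ => Finset.sum_nonneg fun μK _ => ?_
    split_ifs
    · exact mul_nonneg (hp μK).1 (mul_nonneg (hp μ1).2.1 (hp μ2).2.2)
    · exact le_rfl
  -- assemble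
  calc (0 : ℤ) ≤ ∑ γK ∈ EK.powerset, ∑ γ₁ ∈ E₁.powerset, ∑ γ₂ ∈ E₂.powerset,
        ∑ j ∈ J, ((prod j).lam : ℤ) * B (prod j) γK γ₁ γ₂ := by
        rw [Finset.sum_congr rfl fun γK _ => Finset.sum_congr rfl fun γ₁ _ => Finset.sum_comm]
        rw [Finset.sum_congr rfl fun γK _ => Finset.sum_comm]
        rw [Finset.sum_comm]
        refine Finset.sum_nonneg fun j hj => ?_
        have hfac : ∑ γK ∈ EK.powerset, ∑ γ₁ ∈ E₁.powerset, ∑ γ₂ ∈ E₂.powerset,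
            ((prod j).lam : ℤ) * B (prod j) γK γ₁ γ₂ =
            ((prod j).lam : ℤ) * ∑ γK ∈ EK.powerset, ∑ γ₁ ∈ E₁.powerset, ∑ γ₂ ∈ E₂.powerset, B (prod j) γK γ₁ γ₂ := by
          simp only [Finset.mul_sum]
        rw [hfac]
        exact mul_nonneg (Nat.cast_nonneg _) (step3 (prod j) (hval j hj))
    _ ≤ _ := Finset.sum_le_sum fun γK _ => by
        rw [Finset.mul_sum]
        refine Finset.sum_le_sum fun γ₁ _ => ?_
        rw [Finset.mul_sum]
        exact Finset.sum_le_sum fun γ₂ _ => step2 γK γ₁ γ₂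


/-! ### An executable certificate check -/

/-- **Executable product-cone certificate CHECK** (computable `Bool`): for every level offset `d < 8` and every pattern-pair triple,
`Σ_j lam_j · π_j(d; ·) ≤ D · τ_T(d; ·)` for `d < B + 6`, and every product's level shift is `≤ B` (so that both sides vanish for
`d ≥ B + 6` when the corrections are `≤ 2`). [folklore] -/
def certCheck3 (join : Pat3 → Pat3 → Pat3 → Pat3) (corr : Pat3 → Pat3 → Pat3 → ℕ) (T : ℕ → Pat3 → Pat3 → ℤ) (D : ℕ)
    (B : ℕ) (prods : List Prod3) : Bool :=
  (prods.all fun p => decide (p.shift ≤ B)) &&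
    (List.range (B + 6)).all fun d => Pat3.list.all fun PK => Pat3.list.all fun QK => Pat3.list.all fun P1 =>
      Pat3.list.all fun Q1 => Pat3.list.all fun P2 => Pat3.list.all fun Q2 =>
        decide ((prods.map fun p => (p.lam : ℤ) * p.tensor d PK QK P1 Q1 P2 Q2).sum ≤ D * target3 join corr T d PK QK P1 Q1 P2 Q2)

/-- A product with shift `≤ B` has no tensor entries at level offsets `≥ B + 6`. [folklore] -/
theorem Prod3.tensor_eq_zero_of_le (p : Prod3) {B : ℕ} (hp : p.shift ≤ B) {d : ℕ} (hd : B + 6 ≤ d) (PK QK P1 Q1 P2 Q2 : Pat3) :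
    p.tensor d PK QK P1 Q1 P2 Q2 = 0 := by
  unfold Prod3.tensor
  refine Finset.sum_eq_zero fun cK hcK => Finset.sum_eq_zero fun c1 hc1 => Finset.sum_eq_zero fun c2 hc2 => ?_
  rw [Finset.mem_range] at hcK hc1 hc2
  have : ¬ (cK + c1 + c2 + p.shift = d) := by omega
  rw [if_neg this]

/-- With corrections `≤ 2` the target tensor has no entries at level offsets `≥ 6`. [folklore] -/
theorem target3_eq_zero_of_le {join : Pat3 → Pat3 → Pat3 → Pat3} {corr : Pat3 → Pat3 → Pat3 → ℕ}
    (hcorr : ∀ P1 P2 P3, corr P1 P2 P3 ≤ 2) (T : ℕ → Pat3 → Pat3 → ℤ) {B d : ℕ} (hd : B + 6 ≤ d) (PK QK P1 Q1 P2 Q2 : Pat3) :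
    target3 join corr T d PK QK P1 Q1 P2 Q2 = 0 := by
  unfold target3
  refine Finset.sum_eq_zero fun c hc => ?_
  rw [Finset.mem_range] at hc
  have h1 := hcorr PK P1 P2
  have h2 := hcorr QK Q1 Q2
  have : ¬ (corr PK P1 P2 + corr QK Q1 Q2 + c = d) := by omega
  rw [if_neg this]

/-- **What a passed certificate check says**: the entrywise domination at EVERY level offset (the hypothesis `hcert` of
`FK.cone3_level_nonneg`, for the family of products indexed by the list positions). [folklore] -/
theorem certCheck3_spec {join : Pat3 → Pat3 → Pat3 → Pat3} {corr : Pat3 → Pat3 → Pat3 → ℕ} (hcorr : ∀ P1 P2 P3, corr P1 P2 P3 ≤ 2)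
    {T : ℕ → Pat3 → Pat3 → ℤ} {D B : ℕ} {prods : List Prod3} (h : certCheck3 join corr T D B prods = true) (d : ℕ)
    (PK QK P1 Q1 P2 Q2 : Pat3) :
    (prods.map fun p => (p.lam : ℤ) * p.tensor d PK QK P1 Q1 P2 Q2).sum ≤ D * target3 join corr T d PK QK P1 Q1 P2 Q2 := by
  unfold certCheck3 at h
  rw [Bool.and_eq_true] at h
  obtain ⟨hshift, hmain⟩ := h
  simp only [List.all_eq_true, decide_eq_true_eq] at hshift hmain
  by_cases hd : d < B + 6
  · exact hmain d (List.mem_range.2 hd) PK PK.mem_list QK QK.mem_list P1 P1.mem_list Q1 Q1.mem_list P2 P2.mem_list Q2 Q2.mem_list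
  · rw [not_lt] at hd
    rw [target3_eq_zero_of_le hcorr T (B := B) hd, mul_zero]
    refine le_of_eq (List.sum_eq_zero fun x hx => ?_)
    rw [List.mem_map] at hx
    obtain ⟨p, hp, rfl⟩ := hx
    rw [Prod3.tensor_eq_zero_of_le p (hshift p hp) hd, mul_zero]

/-- From the list form of a certificate to the `Finset`-indexed form used by `FK.cone3_level_nonneg`. [folklore] -/
theorem list_sum_eq_finset_sum (prods : List Prod3) (f : Prod3 → ℤ) :
    (prods.map f).sum = ∑ j : Fin prods.length, f (prods.get j) := by
  have h1 : prods.map f = List.ofFn (f ∘ prods.get) := by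
    rw [← List.map_ofFn, List.ofFn_get]
  rw [h1, List.sum_ofFn]
  rfl


end Cone

end FK

end Summit.CriticalPhenomena.PercolationContinuityZ3.Theorems

end
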